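import Summits.QuantumFields.YangMills.Theorems.BalabanUVNodesN09TransportPositiveOnDomainOfFibredChart
import Literature.MathematicalPhysics.QuantumFieldTheory.Balaban1983to89.HaarEigenvalueSphereNull
import Literature.Analysis.Calculus.RealAnalyticZeroSetAddHaar

/-!
# NODE N09 · THE FIBRE-NULLITY `hnull` OF THE (F1) TOWER FROM ANALYTICITY OF THE CHART IN THE FIBRE COORDINATE: along a chart `z ↦ Φ(V₀, z)` through the critical
# configuration that is REAL-ANALYTIC on a connected open set of a finite-dimensional fibre space, the exact-threshold sets `{z | fluctDev_k(Φ(V₀,z))(b) = ε₁}`, `ε₁ ≠ 0`,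
# are Lebesgue-null (the norm `|U − 1|` of a unitary is attained on the spectrum; `det(λ·1 − ·)` is a polynomial; Mityagin)

Cell `pub-ymgap` (YM-PLAN Track A), DAG node N09 [Balaban1987RG1] (= [I]); seat `pub-ymgap-dag-n09-w1` g5 (D-0149 width seat 1 of node N09), FILE 8; count-neutral K1-face
helper keyed to K1⁹ `StabilityBRunRowsAtRecordR13SepCoPHV` = stmt-QuantumFields-27364 (KEY MAP v2; `--kind proof --supports … --as helper`).  HONEST FRAMING: kernel linear algebra ∕ measure
theory BY NAME (this lineage's g4 `HaarEigenvalueSphereNull.exists_mem_spectrum_norm_sub_one_eq`, the tree's [Mityagin2015] `addHaar_zeroSet_eq_zero_of_analyticOnNhd_complex`);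
NOTHING of Bałaban's analysis asserted; the chart is DISPLAYED ((M3r) UNOWNED); N09 NOT discharged; K0⁷∕K1⁹∕K3⁸ NOT closed; counts unmoved (typed 28∕28 · discharged 5∕27); one finite
𝕋⁴ programme at fixed ε — R4 closes the conditional rung `BalabanLadder.UV` only; the Yang–Mills mass gap (Clay) is NOT proved by any of this; nothing continuum ∕ ℝ⁴ ∕ OS.

WHY.  After FILES 5–7 the per-step inputs of N09's analytic inclusion `hreg` are the chart sockets, the base point, joint continuity with compact confined support, N07's
`hcrit`∕`hsolν`, (I19), numerics — and ONE measure-theoretic letter: `hnull`, the `τ`-nullity of the EXACT-THRESHOLD sets `{z | fluctDev_k(Φ(V₀,z))(b) = ε₁}` at every `V₀`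
(dag-n09-w6 g2's moving-threshold mechanism).  For [I]'s (2.10) chart the fibre coordinate `B₁` ranges in a box of the finite-dimensional real space `ker Q̃`, the fibre measure
is Lebesgue, and `B₁ ↦ exp(i(B₁ + hD_W B₁))·V^{(k)}(W)` is REAL-ANALYTIC (exponential ∘ analytic implicit function); along it the deviation at a bond `b` is
`‖W_b(B₁) − 1‖` for the unitary `W_b(B₁) = V^{(k)}(W)(b)⁻¹·Φ(W,B₁)(b)`, with `W_b(0) = 1`.  THIS FILE proves the nullity from exactly that: `‖u − 1‖` of a unitary `u` is attained
at an eigenvalue `λ` (`|λ| = 1`, `|λ − 1| = ‖u − 1‖`; g4's lemma), the admissible `λ` for a given `r` are at most two, `z ↦ det(λ·1 − W(z))` is real-analytic with value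
`(λ − 1)^N ≠ 0` at the base point (`λ ≠ 1` since `r ≠ 0`), so each `{det = 0}` is null on the connected open set (Mityagin) and `{‖W(z) − 1‖ = r}` lies in their union.

WHAT IS PROVED (theorems only; 0 def; 0 sorry; axioms standard).
* §1 matrix bookkeeping: `det_algebraMap_sub_eq_zero_iff'` (`det(λ·1 − M) = 0 ↔ λ ∈ σ(M)`), `det_algebraMap_sub_one'`, `analyticOnNhd_det'` (det is a polynomial),
  `finite_setOf_norm_eq_one_and_norm_sub_one_eq'` (at most two unit complex numbers at distance `r` from `1`) — public twins of g4's private lemmas.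
* §2 ★★ `addHaar_setOf_norm_sub_one_eq_eq_zero_of_analyticOnNhd` (generic: `E` finite-dimensional real, `η` an add-Haar measure, `O ⊆ E` open connected, `W : E → M_N(ℂ)`
  real-analytic on `O` with unitary values, `W z₀ = 1` at some `z₀ ∈ O`, `r ≠ 0` ⇒ `η {z ∈ O | ‖W z − 1‖ = r} = 0`); `measure_setOf_norm_sub_one_eq_eq_zero_of_absolutelyContinuous`
  (the same for any `τ ≪ η` with `τ Oᶜ = 0`, without the `∈ O` clause).
* §3 AT THE RECORD: ★★★ `hnull_of_analyticChart` — the doors' binder VERBATIM: `∀ V₀ ∈ U, ∀ b, ¬ IsB0 b → τ {z | fluctDevOfRecord ν K k (Φ (V₀, z)) b = ε₁} = 0` from: `τ ≪ η`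
  (`η` add-Haar on the finite-dimensional fibre space `Z`), an open connected `O` with `τ Oᶜ = 0`, `Ū(Φ(V₀,z)) = V₀`, the base point `z₀ V₀ ∈ O` with `Φ(V₀, z₀ V₀) = V^{(k)}(V₀)`,
  real-analyticity on `O` of every bond component `z ↦ (Φ(V₀,z)(b) : M_N(ℂ))`, and `ε₁ ≠ 0`.

HONEST SCOPE.  The chart and its analyticity are DISPLAYED (for (2.10): `B12LinearizAnalytic267` + the matrix exponential — the chart seats'); `U(N)`-valued charts would do
(only unitarity of the relative holonomy is used); nothing of g4 ∕ Mityagin re-proved beyond the four public twins of private one-liners in §1.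
-/

noncomputable section

open MeasureTheory Set Filter Topology
open scoped ENNReal NNReal Matrix.Norms.L2Operator
open Literature.MathematicalPhysics.QuantumFieldTheory
open Literature.MathematicalPhysics.QuantumFieldTheory.Balaban1983to89
open Literature.MathematicalPhysics.QuantumFieldTheory.Balaban1983to89.Node00
open Literature.MathematicalPhysics.QuantumFieldTheory.Balaban1983to89.T4Continuum (T4Family)
open Literature.MathematicalPhysics.QuantumFieldTheory.Balaban1983to89.HaarEigenvalueSphereNull (exists_mem_spectrum_norm_sub_one_eq)
open Literature.Analysis.Calculus (addHaar_zeroSet_eq_zero_of_analyticOnNhd_complex)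
open Summit.QuantumFields.YangMills.BalabanUVNodes.N09TransportPositiveOnDomainOfFibredChart (fluctDevOfRecord_eq_of_avg_eq)

namespace Summit.QuantumFields.YangMills.BalabanUVNodes.N09FibreThresholdNullOfAnalyticChart

/-! ## §1 Matrix bookkeeping (public twins of g4's private one-liners) -/

section Matrix

variable {n : Type*} [Fintype n] [DecidableEq n]

/-- `det(λ·1 − M) = 0 ⟺ λ ∈ σ(M)`. [folklore] -/
theorem det_algebraMap_sub_eq_zero_iff' (z : ℂ) (M : Matrix n n ℂ) :
    (algebraMap ℂ (Matrix n n ℂ) z - M).det = 0 ↔ z ∈ spectrum ℂ M := by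
  rw [spectrum.mem_iff, Matrix.isUnit_iff_isUnit_det, isUnit_iff_ne_zero, not_not]

/-- `det(λ·1 − 1) = (λ − 1)^N`. [folklore] -/
theorem det_algebraMap_sub_one' (z : ℂ) : (algebraMap ℂ (Matrix n n ℂ) z - 1).det = (z - 1) ^ Fintype.card n := by
  rw [← map_one (algebraMap ℂ (Matrix n n ℂ)), ← map_sub, Matrix.algebraMap_eq_diagonal, Matrix.det_diagonal]
  simp [Finset.prod_const, Finset.card_univ]

/-- `det` is complex-analytic on `M_N(ℂ)` (a polynomial in the entries). [folklore] -/
theorem analyticOnNhd_det' : AnalyticOnNhd ℂ (fun M : Matrix n n ℂ => M.det) Set.univ := by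
  let e : Matrix n n ℂ →L[ℂ] (n × n → ℂ) :=
    LinearMap.toContinuousLinearMap
      { toFun := fun A p => A p.1 p.2
        map_add' := fun _ _ => rfl
        map_smul' := fun _ _ => rfl }
  have h := AnalyticOnNhd.eval_continuousLinearMap e (Matrix.mvPolynomialX n n ℂ).det
  have heq : (fun M : Matrix n n ℂ => M.det) = fun M => MvPolynomial.eval (e M) (Matrix.mvPolynomialX n n ℂ).det := by
    funext M
    show M.det = MvPolynomial.eval (fun p : n × n => M p.1 p.2) (Matrix.mvPolynomialX n n ℂ).det
    rw [RingHom.map_det, Matrix.mvPolynomialX_mapMatrix_eval]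
  rw [heq]; exact h

/-- At most two unit complex numbers lie at a given distance from `1`: `{z : ‖z‖ = 1 ∧ ‖z − 1‖ = r}` is finite. [folklore] -/
theorem finite_setOf_norm_eq_one_and_norm_sub_one_eq' (r : ℝ) : {z : ℂ | ‖z‖ = 1 ∧ ‖z - 1‖ = r}.Finite := by
  refine (Set.toFinite ({(⟨1 - r ^ 2 / 2, Real.sqrt (1 - (1 - r ^ 2 / 2) ^ 2)⟩ : ℂ),
    (⟨1 - r ^ 2 / 2, -Real.sqrt (1 - (1 - r ^ 2 / 2) ^ 2)⟩ : ℂ)} : Set ℂ)).subset fun z hz => ?_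
  obtain ⟨h1, hr⟩ := hz
  have e1 : z.re ^ 2 + z.im ^ 2 = 1 := by
    have := Complex.sq_norm z
    rw [Complex.normSq_apply, h1] at this
    nlinarith [this]
  have e2 : (z.re - 1) ^ 2 + z.im ^ 2 = r ^ 2 := by
    have := Complex.sq_norm (z - 1)
    rw [Complex.normSq_apply, hr] at this
    simp only [Complex.sub_re, Complex.one_re, Complex.sub_im, Complex.one_im, sub_zero] at this
    nlinarith [this]
  have hre : z.re = 1 - r ^ 2 / 2 := by nlinarith [e1, e2]
  have him : z.im ^ 2 = 1 - (1 - r ^ 2 / 2) ^ 2 := by rw [← hre]; linarith [e1]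
  have habs : |z.im| = Real.sqrt (1 - (1 - r ^ 2 / 2) ^ 2) := by
    rw [← him, Real.sqrt_sq_eq_abs]
  rcases abs_eq_abs.1 (habs.trans (abs_of_nonneg (Real.sqrt_nonneg _)).symm) with h | h
  · exact Or.inl (Complex.ext hre h)
  · exact Or.inr (Complex.ext hre h)

end Matrix

/-! ## §2 Generic: the `r`-sphere `{‖W(z) − 1‖ = r}` of a unitary-valued real-analytic matrix function through `1` is add-Haar-null -/

section Generic

variable {n : Type*} [Fintype n] [DecidableEq n] [Nonempty n]
  {E : Type*} [NormedAddCommGroup E] [NormedSpace ℝ E] [FiniteDimensional ℝ E] [MeasurableSpace E] [BorelSpace E]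
  (η : Measure E) [η.IsAddHaarMeasure]

/-- **★★ THE `r`-SPHERE OF A UNITARY-VALUED REAL-ANALYTIC MATRIX FUNCTION IS NULL.**  `O ⊆ E` open connected, `W : E → M_N(ℂ)` real-analytic on `O` with unitary values on `O`,
`W z₀ = 1` at some `z₀ ∈ O`, `r ≠ 0` ⇒ `η {z ∈ O | ‖W z − 1‖ = r} = 0`: `‖W z − 1‖ = r` puts an eigenvalue `λ` of `W z` on the finite set `{|λ| = 1, |λ − 1| = r}` (g4's
`exists_mem_spectrum_norm_sub_one_eq`), i.e. `det(λ·1 − W z) = 0`; each `z ↦ det(λ·1 − W z)` is real-analytic on `O` with value `(λ − 1)^N ≠ 0` at `z₀`, so its zero set is null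
([Mityagin2015]). [cite: Balaban1985Averaging, (19) p.21 (bookkeeping)] -/
theorem addHaar_setOf_norm_sub_one_eq_eq_zero_of_analyticOnNhd {O : Set E} (hO : IsOpen O) (hOc : IsConnected O) {W : E → Matrix n n ℂ}
    (hW : AnalyticOnNhd ℝ W O) (hWu : ∀ z ∈ O, W z ∈ Matrix.unitaryGroup n ℂ) {z₀ : E} (hz₀ : z₀ ∈ O) (hW₀ : W z₀ = 1) {r : ℝ} (hr : r ≠ 0) :
    η {z ∈ O | ‖W z - 1‖ = r} = 0 := by
  set Λ : Set ℂ := {l : ℂ | ‖l‖ = 1 ∧ ‖l - 1‖ = r} with hΛ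
  have hΛf : Λ.Finite := finite_setOf_norm_eq_one_and_norm_sub_one_eq' r
  -- each eigenvalue hypersurface is null
  have hnull : ∀ l ∈ Λ, η {z ∈ O | (algebraMap ℂ (Matrix n n ℂ) l - W z).det = 0} = 0 := by
    intro l hl
    have hl1 : l ≠ 1 := by
      intro h
      have h2 := hl.2
      rw [h, sub_self, norm_zero] at h2
      exact hr h2.symm
    have han : AnalyticOnNhd ℝ (fun z => (algebraMap ℂ (Matrix n n ℂ) l - W z).det) O := by
      intro z hz
      have h1 : AnalyticAt ℝ (fun z => algebraMap ℂ (Matrix n n ℂ) l - W z) z := analyticAt_const.sub (hW z hz)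
      exact ((analyticOnNhd_det' _ (Set.mem_univ _)).restrictScalars.comp h1)
    refine addHaar_zeroSet_eq_zero_of_analyticOnNhd_complex η hO hOc han ⟨z₀, hz₀, ?_⟩
    rw [hW₀, det_algebraMap_sub_one']
    exact pow_ne_zero _ (sub_ne_zero.2 hl1)
  -- the sphere lies in the finite union
  have hsub : {z ∈ O | ‖W z - 1‖ = r} ⊆ ⋃ l ∈ Λ, {z ∈ O | (algebraMap ℂ (Matrix n n ℂ) l - W z).det = 0} := by
    rintro z ⟨hz, hzr⟩
    obtain ⟨l, hlσ, hl1, hlr⟩ := exists_mem_spectrum_norm_sub_one_eq (⟨W z, hWu z hz⟩ : Matrix.unitaryGroup n ℂ)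
    refine Set.mem_iUnion₂.2 ⟨l, ⟨hl1, by rw [hlr]; exact hzr⟩, hz, ?_⟩
    exact (det_algebraMap_sub_eq_zero_iff' l (W z)).2 hlσ
  exact measure_mono_null hsub ((measure_biUnion_null_iff hΛf.countable).2 hnull)

/-- The same for any measure `τ ≪ η` carried by `O`: `τ {z | ‖W z − 1‖ = r} = 0`. [cite: Balaban1985Averaging, (19) p.21 (bookkeeping)] -/
theorem measure_setOf_norm_sub_one_eq_eq_zero_of_absolutelyContinuous {τ : Measure E} (hτ : τ ≪ η) {O : Set E} (hO : IsOpen O) (hOc : IsConnected O)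
    (hτO : τ Oᶜ = 0) {W : E → Matrix n n ℂ} (hW : AnalyticOnNhd ℝ W O) (hWu : ∀ z ∈ O, W z ∈ Matrix.unitaryGroup n ℂ) {z₀ : E} (hz₀ : z₀ ∈ O)
    (hW₀ : W z₀ = 1) {r : ℝ} (hr : r ≠ 0) :
    τ {z | ‖W z - 1‖ = r} = 0 := by
  have h1 : τ {z ∈ O | ‖W z - 1‖ = r} = 0 := hτ (addHaar_setOf_norm_sub_one_eq_eq_zero_of_analyticOnNhd η hO hOc hW hWu hz₀ hW₀ hr)
  have hsub : {z | ‖W z - 1‖ = r} ⊆ {z ∈ O | ‖W z - 1‖ = r} ∪ Oᶜ := by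
    intro z hz
    by_cases hzO : z ∈ O
    · exact Or.inl ⟨hzO, hz⟩
    · exact Or.inr hzO
  exact measure_mono_null hsub (measure_union_null h1 hτO)

end Generic

/-! ## §3 At the record: the doors' `hnull` from analyticity of the chart's bond components in the fibre coordinate -/

section Record

variable {F : T4Family} {N : ℕ} [NeZero N]
  {Z : Type*} [NormedAddCommGroup Z] [NormedSpace ℝ Z] [FiniteDimensional ℝ Z] [MeasurableSpace Z] [BorelSpace Z]
  (η : Measure Z) [η.IsAddHaarMeasure]

omit [NormedAddCommGroup Z] [NormedSpace ℝ Z] [FiniteDimensional ℝ Z] [MeasurableSpace Z] [BorelSpace Z] in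
/-- The relative holonomy along the chart at a bond, as a matrix function of the fibre coordinate, is unitary-valued, equals `1` at the base point, and its distance to `1`
IS the (2.9) deviation (`dist1 U = ‖U − 1‖` on `SU(N)`, `Ū(Φ(V₀,z)) = V₀`). [cite: Balaban1987RG1, (2.9) p.266 (bookkeeping)] -/
theorem fluctDevOfRecord_chart_eq_norm (ν : Stage7Numerics) {K k : ℕ} {Φ : (PBond (F.P K) (k + 1) → SU N) × Z → GaugeField (F.P K) k (SU N)}
    {V₀ : PBond (F.P K) (k + 1) → SU N} (havgΦ : ∀ z, (avOfRecord F N K k).avg (Φ (V₀, z)) = V₀) (b : PBond (F.P K) k) (z : Z) :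
    fluctDevOfRecord F N ν K k (Φ (V₀, z)) b
      = ‖(((critCfgOfRecord F N ν K k V₀ b)⁻¹ * Φ (V₀, z) b : SU N) : Matrix (Fin N) (Fin N) ℂ) - 1‖ := by
  rw [fluctDevOfRecord_eq_of_avg_eq ν (havgΦ z) b]
  rfl

/-- **★★★ THE DOORS' `hnull` FROM ANALYTICITY OF THE CHART IN THE FIBRE COORDINATE.**  Fibre space `Z` finite-dimensional real with an add-Haar measure `η`, fibre measure
`τ ≪ η` carried by an open connected `O` (`τ Oᶜ = 0`); a chart `Φ` over `U` with `Ū(Φ(V₀,z)) = V₀`, base point `z₀ V₀ ∈ O` with `Φ(V₀, z₀ V₀) = V^{(k)}(V₀)`, and every bond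
component `z ↦ (Φ(V₀,z)(b) : M_N(ℂ))` REAL-ANALYTIC on `O`; threshold `ε₁ ≠ 0`.  THEN `τ {z | fluctDev_k(Φ(V₀,z))(b) = ε₁} = 0` for every `V₀ ∈ U` and every bond `b` — the `hnull`
binder of FILES 2–7 (stated there for the non-distinguished bonds; here for all). [cite: Balaban1987RG1, (2.9) p.266 and (2.10) p.267; Balaban1985Averaging, (19) p.21] -/
theorem hnull_of_analyticChart (ν : Stage7Numerics) {ε₁ : ℝ} (hε : ε₁ ≠ 0) {K k : ℕ} {τ : Measure Z} (hτ : τ ≪ η)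
    {O : Set Z} (hO : IsOpen O) (hOc : IsConnected O) (hτO : τ Oᶜ = 0)
    {Φ : (PBond (F.P K) (k + 1) → SU N) × Z → GaugeField (F.P K) k (SU N)} {U : Set (PBond (F.P K) (k + 1) → SU N)}
    (havgΦ : ∀ V ∈ U, ∀ z, (avOfRecord F N K k).avg (Φ (V, z)) = V)
    (z₀ : (PBond (F.P K) (k + 1) → SU N) → Z) (hz₀O : ∀ V ∈ U, z₀ V ∈ O)
    (hz₀ : ∀ V ∈ U, Φ (V, z₀ V) = critCfgOfRecord F N ν K k V)
    (han : ∀ V ∈ U, ∀ b : PBond (F.P K) k, AnalyticOnNhd ℝ (fun z => ((Φ (V, z) b : SU N) : Matrix (Fin N) (Fin N) ℂ)) O) :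
    ∀ V₀ ∈ U, ∀ b : PBond (F.P K) k, ¬ IsB0 b → τ {z | fluctDevOfRecord F N ν K k (Φ (V₀, z)) b = ε₁} = 0 := by
  intro V₀ hV₀ b _
  have hset : {z | fluctDevOfRecord F N ν K k (Φ (V₀, z)) b = ε₁}
      = {z | ‖(((critCfgOfRecord F N ν K k V₀ b)⁻¹ * Φ (V₀, z) b : SU N) : Matrix (Fin N) (Fin N) ℂ) - 1‖ = ε₁} := by
    ext z
    rw [Set.mem_setOf_eq, Set.mem_setOf_eq, fluctDevOfRecord_chart_eq_norm ν (havgΦ V₀ hV₀) b z]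
  rw [hset]
  -- the relative holonomy is unitary-valued, real-analytic on `O` (a constant matrix times an analytic one), and `= 1` at the base point
  have hWu : ∀ z ∈ O, (((critCfgOfRecord F N ν K k V₀ b)⁻¹ * Φ (V₀, z) b : SU N) : Matrix (Fin N) (Fin N) ℂ) ∈ Matrix.unitaryGroup (Fin N) ℂ :=
    fun z _ => (Matrix.mem_specialUnitaryGroup_iff.1 ((critCfgOfRecord F N ν K k V₀ b)⁻¹ * Φ (V₀, z) b).2).1
  have hWan : AnalyticOnNhd ℝ (fun z => (((critCfgOfRecord F N ν K k V₀ b)⁻¹ * Φ (V₀, z) b : SU N) : Matrix (Fin N) (Fin N) ℂ)) O := by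
    intro z hz
    have h1 : AnalyticAt ℝ (fun z => (((critCfgOfRecord F N ν K k V₀ b)⁻¹ : SU N) : Matrix (Fin N) (Fin N) ℂ) *
        ((Φ (V₀, z) b : SU N) : Matrix (Fin N) (Fin N) ℂ)) z :=
      analyticAt_const.mul (han V₀ hV₀ b z hz)
    exact h1.congr (Filter.Eventually.of_forall fun z' => rfl)
  have hW₀ : (((critCfgOfRecord F N ν K k V₀ b)⁻¹ * Φ (V₀, z₀ V₀) b : SU N) : Matrix (Fin N) (Fin N) ℂ) = 1 := by
    rw [hz₀ V₀ hV₀, inv_mul_cancel]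
    rfl
  exact measure_setOf_norm_sub_one_eq_eq_zero_of_absolutelyContinuous η hτ hO hOc hτO hWan hWu (hz₀O V₀ hV₀) hW₀ hε

end Record

end Summit.QuantumFields.YangMills.BalabanUVNodes.N09FibreThresholdNullOfAnalyticChart

end
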